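import Literature.Barriers.ValiantsHypothesis.FullRankMultilinearProofs
import Mathlib.Algebra.MvPolynomial.PDeriv
import Mathlib.LinearAlgebra.Matrix.Rank
import Mathlib.Data.Nat.Choose.Bounds
import HarnessLib

/-!
# The partial derivative matrix: rank calculus (Alon–Kumar–Volk 2020, Prop. 8)

Support file for the proof of `Literature.Barriers.ValiantsHypothesis.AlonKumarVolk2020_thm20`.
For `g ∈ K[σ]` and sets of variables `Y`, `Z` we use the coefficient matrix indexed by ALL
pairs of finite sets, `cm g Y Z P Q = coeff (∏_{P ∪ Q} x) g` if `P ⊆ Y`, `Q ⊆ Z` and `0`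
otherwise (zero rows/columns do not change the rank; this avoids subtype indices), and prove
the rank facts of [AlonKumarVolk2020, Prop. 8] in the form used in Lemma 23:

* `rank_cm_sum_le` — subadditivity (item 2);
* `rank_cm_le_pow_of_supported`, `rank_cm_le_of_totalDegree_le` — a polynomial in the
  variables `W` has rank `≤ 2^{|Y ∩ W|}`; a polynomial of degree `≤ d` has rank
  `≤ #{P ⊆ Y : |P| ≤ d} ≤ (d+1)|Y|^d` (items 1 and 5);
* `rank_cm_mul_le` — for `g ∈ K[Sᶜ]`, `h ∈ K[S]`:
  `rank M_{Y,Z}(g h) ≤ 2^{|Z ∩ Sᶜ| + |Y ∩ S|}` (a sum of that many rank-one matrices; with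
  item 1 this is the bound `2^{n - τ}`-type bound of RSY08 Claim 5.7 / item 3);
* `rank_cm_pderiv_ge_of_isFullRank` — if `g` is of full rank (`IsFullRank`) then for every
  balanced `Y` and every variable `x`, `rank M_{Y,Yᶜ}(∂g/∂x) ≥ 2^{n-1}` (item 4), through
  the bridge `rank_pdMatrix_rename` between the tree's `pdMatrix (rename A g)` and `cm`.

## References
* [AlonKumarVolk2020] N. Alon, M. Kumar, B. L. Volk, Combinatorica 40 (2020), §2.2, Prop. 8.
* [RazYehudayoff2008] R. Raz, A. Yehudayoff, Comput. Complexity 17 (2008), §4.2.2.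
-/

noncomputable section

namespace Literature.Barriers.ValiantsHypothesis.AKV

open MvPolynomial Finset RazYehudayoff

variable {K : Type*} [Field K]

/-! ### Generic rank lemmas -/

section Generic

variable {m n : Type*} [Fintype n]

/-- `rank (A + B) ≤ rank A + rank B`. [folklore] -/
theorem rank_add_le' (A B : Matrix m n K) : (A + B).rank ≤ A.rank + B.rank := by
  unfold Matrix.rank
  rw [Matrix.mulVecLin_add]
  exact (Submodule.finrank_mono (LinearMap.range_add_le _ _)).trans
    (Submodule.finrank_add_le_finrank_add_finrank _ _)

/-- `rank (∑ Aᵢ) ≤ ∑ rank Aᵢ`. [folklore] -/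
theorem rank_sum_le' {ι : Type*} (s : Finset ι) (A : ι → Matrix m n K) :
    (∑ i ∈ s, A i).rank ≤ ∑ i ∈ s, (A i).rank := by
  classical
  induction s using Finset.induction_on with
  | empty => simp
  | insert a s ha ih =>
    rw [Finset.sum_insert ha, Finset.sum_insert ha]
    exact (rank_add_le' _ _).trans (Nat.add_le_add_left ih _)

/-- A matrix whose rows outside `R` vanish has rank `≤ |R|`. [folklore] -/
theorem rank_le_card_of_rows [Fintype m] [DecidableEq m] (A : Matrix m n K) (R : Finset m)
    (hA : ∀ i ∉ R, ∀ j, A i j = 0) : A.rank ≤ R.card := by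
  classical
  have hE : A = Matrix.diagonal (fun i => if i ∈ R then (1 : K) else 0) * A := by
    ext i j
    rw [Matrix.diagonal_mul]
    by_cases hi : i ∈ R
    · simp [hi]
    · simp [hi, hA i hi j]
  rw [hE]
  refine (Matrix.rank_mul_le_left _ _).trans ?_
  rw [Matrix.rank_diagonal]
  refine le_of_eq ?_
  rw [Fintype.card_subtype]
  congr 1
  ext i
  simp

/-- Zero rows can be deleted without changing the rank: if `A` vanishes outside the rows
`range r` (`r` injective) then `rank A ≤ rank (A.submatrix r id)`. [folklore] -/
theorem rank_le_rank_submatrix_rows {m₀ : Type*} [Fintype m₀] [Fintype m] (A : Matrix m n K)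
    (r : m₀ → m) (hr : Function.Injective r) (hrow : ∀ i, (∀ i₀, r i₀ ≠ i) → ∀ j, A i j = 0) :
    A.rank ≤ (A.submatrix r id).rank := by
  classical
  have hA : A = (Matrix.of fun i i₀ => if r i₀ = i then (1 : K) else 0) * A.submatrix r id := by
    ext i j
    rw [Matrix.mul_apply]
    simp only [Matrix.submatrix_apply, Matrix.of_apply, id]
    by_cases hi : ∃ i₀, r i₀ = i
    · obtain ⟨i₀, rfl⟩ := hi
      rw [Finset.sum_eq_single i₀]
      · simp
      · intro i₁ _ hne
        rw [if_neg (fun h => hne (hr h)), zero_mul]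
      · intro h
        exact absurd (Finset.mem_univ i₀) h
    · push Not at hi
      rw [hrow i hi]
      symm
      exact Finset.sum_eq_zero fun i₀ _ => by rw [if_neg (hi i₀), zero_mul]
  conv_lhs => rw [hA]
  exact Matrix.rank_mul_le_right _ _

/-- Zero columns can be deleted without changing the rank: if `A` vanishes outside the
columns `range c` (`c` injective) then `rank A ≤ rank (A.submatrix id c)`. [folklore] -/
theorem rank_le_rank_submatrix_cols {n₀ : Type*} [Fintype n₀] [Fintype m] (A : Matrix m n K)
    (c : n₀ → n) (hc : Function.Injective c) (hcol : ∀ j, (∀ j₀, c j₀ ≠ j) → ∀ i, A i j = 0) :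
    A.rank ≤ (A.submatrix id c).rank := by
  classical
  have hA : A = A.submatrix id c * (Matrix.of fun j₀ j => if c j₀ = j then (1 : K) else 0) := by
    ext i j
    rw [Matrix.mul_apply]
    simp only [Matrix.submatrix_apply, Matrix.of_apply, id]
    by_cases hj : ∃ j₀, c j₀ = j
    · obtain ⟨j₀, rfl⟩ := hj
      rw [Finset.sum_eq_single j₀]
      · simp
      · intro j₁ _ hne
        rw [if_neg (fun h => hne (hc h)), mul_zero]
      · intro h
        exact absurd (Finset.mem_univ j₀) h
    · push Not at hj
      rw [hcol j hj]
      symm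
      exact Finset.sum_eq_zero fun j₀ _ => by rw [if_neg (hj j₀), mul_zero]
  conv_lhs => rw [hA]
  exact Matrix.rank_mul_le_left _ _

/-- **Extension by zero does not change the rank**: if `A` vanishes outside the rows
`range r` and the columns `range c` (`r`, `c` injective), then `rank (A.submatrix r c) = rank A`.
[folklore] -/
theorem rank_submatrix_of_vanish {m₀ n₀ : Type*} [Fintype m₀] [Fintype n₀] [Fintype m]
    (A : Matrix m n K) (r : m₀ → m) (c : n₀ → n) (hr : Function.Injective r)
    (hc : Function.Injective c) (hrow : ∀ i, (∀ i₀, r i₀ ≠ i) → ∀ j, A i j = 0)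
    (hcol : ∀ j, (∀ j₀, c j₀ ≠ j) → ∀ i, A i j = 0) :
    (A.submatrix r c).rank = A.rank := by
  refine le_antisymm (Matrix.rank_submatrix_le _ _ _) ?_
  calc A.rank ≤ (A.submatrix r id).rank := rank_le_rank_submatrix_rows A r hr hrow
    _ ≤ ((A.submatrix r id).submatrix id c).rank :=
        rank_le_rank_submatrix_cols _ c hc (fun j hj i₀ => hcol j hj (r i₀))
    _ = (A.submatrix r c).rank := rfl

/-- Rows of a full-row-rank matrix stay independent: a submatrix on an injective family of
rows of a matrix with `rank = #rows` has `rank = #(selected rows)`. [folklore] -/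
theorem rank_submatrix_rows_of_rank_eq {m₀ : Type*} [Fintype m₀] [Fintype m] (A : Matrix m n K)
    (hA : A.rank = Fintype.card m) (r : m₀ → m) (hr : Function.Injective r) :
    (A.submatrix r id).rank = Fintype.card m₀ := by
  have hli : LinearIndependent K A.row := by
    rw [linearIndependent_iff_card_eq_finrank_span, Set.finrank, ← Matrix.rank_eq_finrank_span_row]
    exact hA.symm
  have hli' : LinearIndependent K (A.submatrix r id).row := hli.comp r hr
  exact hli'.rank_matrix

end Generic

/-! ### The coefficient matrix on all pairs of sets -/

section CM

variable {σ : Type*} [Fintype σ] [DecidableEq σ]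

/-- The coefficient ("partial derivative") matrix of `g` with respect to `(Y, Z)`, indexed by
all pairs of finite sets of variables: the coefficient of `∏_{P ∪ Q} x_k` for `P ⊆ Y`,
`Q ⊆ Z`, and `0` otherwise. [cite: AlonKumarVolk2020, §2.2] -/
def cm (g : MvPolynomial σ K) (Y Z : Finset σ) : Matrix (Finset σ) (Finset σ) K :=
  Matrix.of fun P Q => if P ⊆ Y ∧ Q ⊆ Z then coeff (ind (P ∪ Q)) g else 0

omit [Fintype σ] in
/-- Entries of `cm`. [folklore] -/
@[simp] theorem cm_apply (g : MvPolynomial σ K) (Y Z P Q : Finset σ) :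
    cm g Y Z P Q = if P ⊆ Y ∧ Q ⊆ Z then coeff (ind (P ∪ Q)) g else 0 := rfl

omit [Fintype σ] in
/-- `cm` is additive in the polynomial. [folklore] -/
theorem cm_add (g h : MvPolynomial σ K) (Y Z : Finset σ) : cm (g + h) Y Z = cm g Y Z + cm h Y Z := by
  ext P Q
  simp only [cm_apply, Matrix.add_apply, coeff_add]
  split_ifs <;> simp

omit [Fintype σ] in
/-- `cm` of a finite sum. [folklore] -/
theorem cm_sum {ι : Type*} (s : Finset ι) (g : ι → MvPolynomial σ K) (Y Z : Finset σ) :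
    cm (∑ i ∈ s, g i) Y Z = ∑ i ∈ s, cm (g i) Y Z := by
  classical
  induction s using Finset.induction_on with
  | empty => ext P Q; simp
  | insert a s ha ih => rw [Finset.sum_insert ha, Finset.sum_insert ha, cm_add, ih]

/-- **[AlonKumarVolk2020, Prop. 8 (2)]** subadditivity of the rank. [cite: AlonKumarVolk2020, Prop. 8] -/
theorem rank_cm_sum_le {ι : Type*} (s : Finset ι) (g : ι → MvPolynomial σ K) (Y Z : Finset σ) :
    (cm (∑ i ∈ s, g i) Y Z).rank ≤ ∑ i ∈ s, (cm (g i) Y Z).rank := by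
  rw [cm_sum]
  exact rank_sum_le' _ _

/-- `rank (cm (g + h)) ≤ rank (cm g) + rank (cm h)`. [cite: AlonKumarVolk2020, Prop. 8] -/
theorem rank_cm_add_le (g h : MvPolynomial σ K) (Y Z : Finset σ) :
    (cm (g + h) Y Z).rank ≤ (cm g Y Z).rank + (cm h Y Z).rank := by
  rw [cm_add]
  exact rank_add_le' _ _

omit [Fintype σ] in
/-- Transposing swaps `Y` and `Z`. [folklore] -/
theorem cm_transpose (g : MvPolynomial σ K) (Y Z : Finset σ) :
    (cm g Y Z).transpose = cm g Z Y := by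
  ext Q P
  simp only [Matrix.transpose_apply, cm_apply, Finset.union_comm P Q]
  by_cases h : P ⊆ Y ∧ Q ⊆ Z
  · rw [if_pos h, if_pos ⟨h.2, h.1⟩]
  · rw [if_neg h, if_neg (fun h' => h ⟨h'.2, h'.1⟩)]

/-- The rank is symmetric in `(Y, Z)`. [folklore] -/
theorem rank_cm_swap (g : MvPolynomial σ K) (Y Z : Finset σ) :
    (cm g Y Z).rank = (cm g Z Y).rank := by
  rw [← cm_transpose, Matrix.rank_transpose]

omit [Fintype σ] [DecidableEq σ] in
/-- A coefficient outside the variables of `g` vanishes. [folklore] -/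
theorem coeff_ind_eq_zero_of_not_subset {g : MvPolynomial σ K} {W : Finset σ}
    (hg : g ∈ supported K (↑W : Set σ)) {A : Finset σ} (hA : ¬ A ⊆ W) : coeff (ind A) g = 0 := by
  by_contra h
  apply hA
  have := support_subset_of_mem_supported hg h
  rwa [support_ind] at this

/-- **[AlonKumarVolk2020, Prop. 8 (1)], relative form.** A polynomial in the variables `W`
has `rank M_{Y,Z} ≤ 2^{|Y ∩ W|}`. [cite: AlonKumarVolk2020, Prop. 8] -/
theorem rank_cm_le_pow_of_supported {g : MvPolynomial σ K} {W : Finset σ}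
    (hg : g ∈ supported K (↑W : Set σ)) (Y Z : Finset σ) :
    (cm g Y Z).rank ≤ 2 ^ (Y ∩ W).card := by
  classical
  rw [← Finset.card_powerset]
  refine rank_le_card_of_rows _ _ fun P hP Q => ?_
  rw [Finset.mem_powerset, Finset.subset_inter_iff] at hP
  simp only [cm_apply]
  split_ifs with h
  · exact coeff_ind_eq_zero_of_not_subset hg fun h' => hP ⟨h.1, (Finset.subset_union_left).trans h'⟩
  · rfl

omit [Fintype σ] in
/-- A coefficient at a multilinear monomial of degree above `totalDegree g` vanishes. [folklore] -/
theorem coeff_ind_eq_zero_of_totalDegree_lt {g : MvPolynomial σ K} {A : Finset σ}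
    (hA : g.totalDegree < A.card) : coeff (ind A) g = 0 := by
  by_contra h
  have hmem : ind A ∈ g.support := mem_support_iff.2 h
  have := le_totalDegree hmem
  have hsum : ((ind A).sum fun _ e => e) = A.card := by
    rw [Finsupp.sum, support_ind, Finset.card_eq_sum_ones]
    exact Finset.sum_congr rfl fun k hk => by rw [ind_apply, if_pos hk]
  omega

/-- **[AlonKumarVolk2020, Prop. 8 (5)]** A polynomial of total degree `≤ d` has
`rank M_{Y,Z} ≤ #{P ⊆ Y : |P| ≤ d}`. [cite: AlonKumarVolk2020, Prop. 8] -/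
theorem rank_cm_le_card_of_totalDegree_le {g : MvPolynomial σ K} {d : ℕ} (hg : g.totalDegree ≤ d)
    (Y Z : Finset σ) :
    (cm g Y Z).rank ≤ (Y.powerset.filter (fun P => P.card ≤ d)).card := by
  classical
  refine rank_le_card_of_rows _ _ fun P hP Q => ?_
  rw [Finset.mem_filter, Finset.mem_powerset] at hP
  simp only [cm_apply]
  split_ifs with h
  · apply coeff_ind_eq_zero_of_totalDegree_lt
    have hPd : d < P.card := by
      by_contra h'
      exact hP ⟨h.1, not_lt.1 h'⟩
    exact lt_of_le_of_lt hg (hPd.trans_le (Finset.card_le_card Finset.subset_union_left))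
  · rfl

omit [Fintype σ] in
/-- Counting: `#{P ⊆ Y : |P| ≤ d} ≤ (d+1) |Y|^d` for `|Y| ≥ 1`. [folklore] -/
theorem card_powerset_filter_card_le (Y : Finset σ) (d : ℕ) (hY : 1 ≤ Y.card) :
    (Y.powerset.filter (fun P => P.card ≤ d)).card ≤ (d + 1) * Y.card ^ d := by
  classical
  have hsub : Y.powerset.filter (fun P => P.card ≤ d) =
      (Finset.range (d + 1)).biUnion (fun i => Y.powersetCard i) := by
    ext P
    simp only [Finset.mem_filter, Finset.mem_powerset, Finset.mem_biUnion, Finset.mem_range,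
      Finset.mem_powersetCard]
    constructor
    · rintro ⟨h1, h2⟩
      exact ⟨P.card, Nat.lt_succ_of_le h2, h1, rfl⟩
    · rintro ⟨i, hi, h1, rfl⟩
      exact ⟨h1, Nat.lt_succ_iff.1 hi⟩
  rw [hsub]
  calc ((Finset.range (d + 1)).biUnion (fun i => Y.powersetCard i)).card
      ≤ ∑ i ∈ Finset.range (d + 1), (Y.powersetCard i).card := Finset.card_biUnion_le
    _ ≤ ∑ _i ∈ Finset.range (d + 1), Y.card ^ d := by
        refine Finset.sum_le_sum fun i hi => ?_
        rw [Finset.card_powersetCard]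
        exact (Nat.choose_le_pow _ _).trans
          (Nat.pow_le_pow_right hY (Nat.lt_succ_iff.1 (Finset.mem_range.1 hi)))
    _ = (d + 1) * Y.card ^ d := by simp

/-- **Rank of a product of polynomials in disjoint variables** ([AlonKumarVolk2020, Prop. 8
(1)+(3)] as used in RSY08 Claim 5.7): for `g ∈ K[Sᶜ]` and `h ∈ K[S]`,
`rank M_{Y,Z}(g h) ≤ 2^{|Z ∩ Sᶜ| + |Y ∩ S|}` — `M_{Y,Z}(g h)` is a sum of `2^{|Z ∩ Sᶜ|} 2^{|Y ∩ S|}`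
rank-one matrices. [cite: AlonKumarVolk2020, Prop. 8] -/
theorem rank_cm_mul_le {g h : MvPolynomial σ K} (S : Finset σ)
    (hg : g ∈ supported K (↑(Sᶜ) : Set σ)) (hh : h ∈ supported K (↑S : Set σ)) (Y Z : Finset σ) :
    (cm (g * h) Y Z).rank ≤ 2 ^ ((Z ∩ Sᶜ).card + (Y ∩ S).card) := by
  classical
  -- the rank-one pieces
  let c : Finset σ → Finset σ → Finset σ → K := fun A B P =>
    if P ⊆ Y ∧ P ∩ S = B then coeff (ind (P ∩ Sᶜ ∪ A)) g else 0
  let r : Finset σ → Finset σ → Finset σ → K := fun A B Q =>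
    if Q ⊆ Z ∧ Q ∩ Sᶜ = A then coeff (ind (B ∪ (Q ∩ S))) h else 0
  have hdec : cm (g * h) Y Z =
      ∑ A ∈ (Z ∩ Sᶜ).powerset, ∑ B ∈ (Y ∩ S).powerset, Matrix.vecMulVec (c A B) (r A B) := by
    ext P Q
    simp only [cm_apply, Matrix.sum_apply, Matrix.vecMulVec_apply]
    by_cases hPQ : P ⊆ Y ∧ Q ⊆ Z
    · rw [if_pos hPQ]
      rw [Finset.sum_eq_single (Q ∩ Sᶜ)]
      · rw [Finset.sum_eq_single (P ∩ S)]
        · simp only [c, r, if_pos (And.intro hPQ.1 rfl), if_pos (And.intro hPQ.2 rfl)]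
          have hsplit : P ∪ Q = (P ∩ Sᶜ ∪ Q ∩ Sᶜ) ∪ (P ∩ S ∪ Q ∩ S) := by
            ext x
            simp only [Finset.mem_union, Finset.mem_inter, Finset.mem_compl]
            tauto
          rw [hsplit, coeff_ind_union_mul (W₁ := Sᶜ) (W₂ := S) disjoint_compl_left hg hh]
          · exact Finset.union_subset Finset.inter_subset_right Finset.inter_subset_right
          · exact Finset.union_subset Finset.inter_subset_right Finset.inter_subset_right
        · intro B _ hB
          simp only [c]
          rw [if_neg (fun h' => hB h'.2.symm), zero_mul]
        · intro hB
          exact absurd (Finset.mem_powerset.2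
            (Finset.inter_subset_inter hPQ.1 (subset_refl _))) hB
      · intro A _ hA
        apply Finset.sum_eq_zero
        intro B _
        simp only [r]
        rw [if_neg (fun h' => hA h'.2.symm), mul_zero]
      · intro hA
        exact absurd (Finset.mem_powerset.2
          (Finset.inter_subset_inter hPQ.2 (subset_refl _))) hA
    · rw [if_neg hPQ]
      symm
      apply Finset.sum_eq_zero
      intro A _
      apply Finset.sum_eq_zero
      intro B _
      simp only [c, r]
      by_cases hP : P ⊆ Y
      · have hQ : ¬ Q ⊆ Z := fun hQ => hPQ ⟨hP, hQ⟩
        exact mul_eq_zero_of_right _ (if_neg (fun h' => hQ h'.1))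
      · exact mul_eq_zero_of_left (if_neg (fun h' => hP h'.1)) _
  rw [hdec]
  calc (∑ A ∈ (Z ∩ Sᶜ).powerset, ∑ B ∈ (Y ∩ S).powerset, Matrix.vecMulVec (c A B) (r A B)).rank
      ≤ ∑ A ∈ (Z ∩ Sᶜ).powerset, (∑ B ∈ (Y ∩ S).powerset, Matrix.vecMulVec (c A B) (r A B)).rank :=
        rank_sum_le' _ _
    _ ≤ ∑ A ∈ (Z ∩ Sᶜ).powerset, ∑ B ∈ (Y ∩ S).powerset, (Matrix.vecMulVec (c A B) (r A B)).rank :=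
        Finset.sum_le_sum fun A _ => rank_sum_le' _ _
    _ ≤ ∑ A ∈ (Z ∩ Sᶜ).powerset, ∑ B ∈ (Y ∩ S).powerset, 1 :=
        Finset.sum_le_sum fun A _ => Finset.sum_le_sum fun B _ => Matrix.rank_vecMulVec_le _ _
    _ = 2 ^ ((Z ∩ Sᶜ).card + (Y ∩ S).card) := by
        simp [Finset.card_powerset, pow_add]

/-- The unbalanced form: with `Y ⊔ Z` a balanced partition of all variables (`|Y| = |Z| = n`),
`g ∈ K[Sᶜ]`, `h ∈ K[S]`: `rank M_{Y,Z}(g h) ≤ 2^{n - e}` whenever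
`e ≤ |2|Y ∩ S| - |S||` (RSY08 Claim 5.7: "`X_v` is `τ`-unbalanced"). [cite: AlonKumarVolk2020, §4 (proof of Lemma 23)] -/
theorem rank_cm_mul_le_of_unbalanced {g h : MvPolynomial σ K} (S : Finset σ)
    (hg : g ∈ supported K (↑(Sᶜ) : Set σ)) (hh : h ∈ supported K (↑S : Set σ))
    (Y : Finset σ) {n e : ℕ} (hY : Y.card = n) (hYc : Yᶜ.card = n)
    (he : (e : ℤ) ≤ |2 * ((Y ∩ S).card : ℤ) - S.card|) :
    (cm (g * h) Y Yᶜ).rank ≤ 2 ^ (n - e) := by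
  classical
  have hS : (Y ∩ S).card + (Yᶜ ∩ S).card = S.card := by
    rw [← Finset.card_union_of_disjoint]
    · congr 1
      ext x
      simp only [Finset.mem_union, Finset.mem_inter, Finset.mem_compl]
      tauto
    · exact Finset.disjoint_of_subset_left Finset.inter_subset_left
        (Finset.disjoint_of_subset_right Finset.inter_subset_left disjoint_compl_right)
  have hYS : (Y ∩ S).card + (Y ∩ Sᶜ).card = n := by
    rw [← hY, ← Finset.card_union_of_disjoint]
    · congr 1
      ext x
      simp only [Finset.mem_union, Finset.mem_inter, Finset.mem_compl]
      tauto
    · exact Finset.disjoint_of_subset_left Finset.inter_subset_right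
        (Finset.disjoint_of_subset_right Finset.inter_subset_right disjoint_compl_right)
  have hYcS : (Yᶜ ∩ S).card + (Yᶜ ∩ Sᶜ).card = n := by
    rw [← hYc, ← Finset.card_union_of_disjoint]
    · congr 1
      ext x
      simp only [Finset.mem_union, Finset.mem_inter, Finset.mem_compl]
      tauto
    · exact Finset.disjoint_of_subset_left Finset.inter_subset_right
        (Finset.disjoint_of_subset_right Finset.inter_subset_right disjoint_compl_right)
  rcases le_or_gt (S.card : ℤ) (2 * ((Y ∩ S).card : ℤ)) with hle | hlt
  · -- `|Y ∩ S| ≥ |S|/2`: use the bound through `(Yᶜ, Y)`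
    rw [abs_of_nonneg (by linarith)] at he
    have h1 := rank_cm_mul_le S hg hh Yᶜ Y
    rw [rank_cm_swap]
    refine h1.trans (Nat.pow_le_pow_right (by norm_num) ?_)
    omega
  · rw [abs_of_neg (by linarith)] at he
    have h1 := rank_cm_mul_le S hg hh Y Yᶜ
    refine h1.trans (Nat.pow_le_pow_right (by norm_num) ?_)
    omega

end CM

/-! ### Derivatives of full-rank polynomials -/

section Deriv

variable {σ : Type*} [Fintype σ] [DecidableEq σ]

omit [Fintype σ] in
/-- `ind (insert x A) = single x 1 + ind A` for `x ∉ A`. [folklore] -/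
theorem ind_insert {x : σ} {A : Finset σ} (hx : x ∉ A) :
    ind (insert x A) = Finsupp.single x 1 + ind A := by
  unfold ind
  rw [Finset.sum_insert hx]

omit [Fintype σ] in
/-- The rows `P ∌ x` of `M_{Y,Z}(∂g/∂x)` are the rows `P ∪ {x}` of `M_{Y,Z}(g)` (`x ∈ Y`,
`Y ∩ Z = ∅`). [cite: AlonKumarVolk2020, Prop. 8 (4)] -/
theorem cm_pderiv_apply {g : MvPolynomial σ K} {Y Z : Finset σ} (hYZ : Disjoint Y Z) {x : σ}
    (hx : x ∈ Y) {P : Finset σ} (hxP : x ∉ P) (Q : Finset σ) :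
    cm (pderiv x g) Y Z P Q = cm g Y Z (insert x P) Q := by
  classical
  simp only [cm_apply]
  by_cases hPQ : P ⊆ Y ∧ Q ⊆ Z
  · have hins : insert x P ⊆ Y := Finset.insert_subset hx hPQ.1
    rw [if_pos hPQ, if_pos ⟨hins, hPQ.2⟩, coeff_pderiv]
    have hxQ : x ∉ Q := fun h => Finset.disjoint_left.1 hYZ hx (hPQ.2 h)
    have hxPQ : x ∉ P ∪ Q := by
      rw [Finset.mem_union, not_or]
      exact ⟨hxP, hxQ⟩
    have h0 : (ind (P ∪ Q)) x = 0 := by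
      rw [ind_apply, if_neg hxPQ]
    rw [h0, Finset.insert_union, ind_insert hxPQ, add_comm (Finsupp.single x 1)]
    simp
  · rw [if_neg hPQ, if_neg]
    rintro ⟨h1, h2⟩
    exact hPQ ⟨(Finset.subset_insert x P).trans h1, h2⟩

/-- **[AlonKumarVolk2020, Prop. 8 (4)], row form.** If `M_{Y,Z}(g)` has full row rank
`2^{|Y|}` (`Y ∩ Z = ∅`) and `x ∈ Y`, then `rank M_{Y,Z}(∂g/∂x) ≥ 2^{|Y| - 1}`.
[cite: AlonKumarVolk2020, Prop. 8] -/
theorem rank_cm_pderiv_ge {g : MvPolynomial σ K} {Y Z : Finset σ} (hYZ : Disjoint Y Z)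
    (hfull : (cm g Y Z).rank = 2 ^ Y.card) {x : σ} (hx : x ∈ Y) :
    2 ^ (Y.card - 1) ≤ (cm (pderiv x g) Y Z).rank := by
  classical
  -- restrict to the rows `⊆ Y`
  let incl : ↥Y.powerset → Finset σ := fun P => P.1
  have hS : ((cm g Y Z).submatrix incl id).rank = (cm g Y Z).rank := by
    refine rank_submatrix_of_vanish _ _ _ Subtype.val_injective Function.injective_id
      (fun P hP Q => ?_) (fun Q hQ P => ?_)
    · simp only [cm_apply]
      rw [if_neg]
      rintro ⟨h1, -⟩
      exact hP ⟨P, Finset.mem_powerset.2 h1⟩ rfl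
    · exact absurd rfl (hQ Q)
  have hcardY : Fintype.card ↥Y.powerset = 2 ^ Y.card := by
    rw [Fintype.card_coe, Finset.card_powerset]
  have hS' : ((cm g Y Z).submatrix incl id).rank = Fintype.card ↥Y.powerset := by
    rw [hS, hfull, hcardY]
  -- the rows `insert x P`, `P ⊆ Y.erase x`
  let φ : ↥(Y.erase x).powerset → ↥Y.powerset := fun P =>
    ⟨insert x P.1, Finset.mem_powerset.2 (Finset.insert_subset hx
      ((Finset.mem_powerset.1 P.2).trans (Finset.erase_subset x Y)))⟩
  have hφ : Function.Injective φ := by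
    rintro ⟨P, hP⟩ ⟨P', hP'⟩ h
    have hxP : x ∉ P := fun h' => Finset.notMem_erase x Y (Finset.mem_powerset.1 hP h')
    have hxP' : x ∉ P' := fun h' => Finset.notMem_erase x Y (Finset.mem_powerset.1 hP' h')
    have h' : insert x P = insert x P' := congrArg Subtype.val h
    ext1
    show P = P'
    rw [← Finset.erase_insert hxP, h', Finset.erase_insert hxP']
  have hrk := rank_submatrix_rows_of_rank_eq _ hS' φ hφ
  have hcard : Fintype.card ↥(Y.erase x).powerset = 2 ^ (Y.card - 1) := by
    rw [Fintype.card_coe, Finset.card_powerset, Finset.card_erase_of_mem hx]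
  -- that submatrix is a submatrix of `cm (pderiv x g)`
  have heq : ((cm g Y Z).submatrix incl id).submatrix φ id =
      (cm (pderiv x g) Y Z).submatrix (fun P : ↥(Y.erase x).powerset => P.1) id := by
    ext P Q
    simp only [Matrix.submatrix_apply, id, incl, φ]
    have hxP : x ∉ P.1 := fun h' => Finset.notMem_erase x Y (Finset.mem_powerset.1 P.2 h')
    rw [cm_pderiv_apply hYZ hx hxP]
  rw [← hcard, ← hrk, heq]
  exact Matrix.rank_submatrix_le _ _ _

end Deriv

/-! ### Bridge to `pdMatrix` and `IsFullRank` -/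

section Bridge

variable {n : ℕ}

/-- `rank M_{(rename A g)} = rank (cm g Y_A Z_A)` with `Y_A`, `Z_A` the positions of the
`Y`- and `Z`-variables of the partition `A`. [cite: RazYehudayoff2008, §4.2.1–4.2.2] -/
theorem rank_pdMatrix_rename (A : Fin (2 * n) ≃ Fin n ⊕ Fin n) (g : MvPolynomial (Fin (2 * n)) K) :
    (pdMatrix (rename A g)).rank =
      (cm g (Finset.univ.map (eY A)) (Finset.univ.map (eZ A))).rank := by
  classical
  set Y := Finset.univ.map (eY A) with hYdef
  set Z := Finset.univ.map (eZ A) with hZdef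
  have hsub : pdMatrix (rename A g) =
      (cm g Y Z).submatrix (fun U : Finset (Fin n) => U.map (eY A)) (fun T => T.map (eZ A)) := by
    ext U T
    rw [pdMatrix_eq_cM]
    simp only [cM, Matrix.of_apply, Matrix.submatrix_apply, cm_apply]
    rw [if_pos ⟨Finset.map_subset_map.2 (Finset.subset_univ U),
      Finset.map_subset_map.2 (Finset.subset_univ T)⟩, coeff_setMonomial_rename]
  rw [hsub]
  refine rank_submatrix_of_vanish _ _ _ (Finset.map_injective (eY A)) (Finset.map_injective (eZ A))
    (fun P hP Q => ?_) (fun Q hQ P => ?_)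
  · simp only [cm_apply]
    rw [if_neg]
    rintro ⟨hPY, -⟩
    refine hP (Finset.univ.filter fun y => eY A y ∈ P) ?_
    ext k
    simp only [Finset.mem_map, Finset.mem_filter, Finset.mem_univ, true_and]
    constructor
    · rintro ⟨y, hy, rfl⟩
      exact hy
    · intro hk
      obtain ⟨y, -, rfl⟩ := Finset.mem_map.1 (hPY hk)
      exact ⟨y, hk, rfl⟩
  · simp only [cm_apply]
    rw [if_neg]
    rintro ⟨-, hQZ⟩
    refine hQ (Finset.univ.filter fun z => eZ A z ∈ Q) ?_
    ext k
    simp only [Finset.mem_map, Finset.mem_filter, Finset.mem_univ, true_and]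
    constructor
    · rintro ⟨z, hz, rfl⟩
      exact hz
    · intro hk
      obtain ⟨z, -, rfl⟩ := Finset.mem_map.1 (hQZ hk)
      exact ⟨z, hk, rfl⟩

/-- Every balanced set of positions is the `Y`-side of some partition `A`. [cite: RazYehudayoff2008, §4.2.1] -/
theorem exists_equiv_of_balanced (Y : Finset (Fin (2 * n))) (hY : Y.card = n) :
    ∃ A : Fin (2 * n) ≃ Fin n ⊕ Fin n,
      Finset.univ.map (eY A) = Y ∧ Finset.univ.map (eZ A) = Yᶜ := by
  classical
  have hYc : Yᶜ.card = n := by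
    rw [Finset.card_compl, Fintype.card_fin, hY]
    omega
  let e1 : ↥Y ≃ Fin n := Finset.equivFinOfCardEq hY
  let e2 : ↥(Yᶜ) ≃ Fin n := Finset.equivFinOfCardEq hYc
  let e2' : {k : Fin (2 * n) // ¬ (k ∈ Y)} ≃ Fin n :=
    (Equiv.subtypeEquivRight (fun k => by rw [Finset.mem_compl])).trans e2
  let A : Fin (2 * n) ≃ Fin n ⊕ Fin n :=
    (Equiv.sumCompl (fun k => k ∈ Y)).symm.trans (Equiv.sumCongr e1 e2')
  have hAinl : ∀ y : Fin n, A.symm (Sum.inl y) = (e1.symm y).1 := by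
    intro y
    simp [A, Equiv.sumCongr_symm, Equiv.sumCompl_apply_inl]
  have hAinr : ∀ z : Fin n, A.symm (Sum.inr z) = (e2'.symm z).1 := by
    intro z
    simp [A, Equiv.sumCongr_symm, Equiv.sumCompl_apply_inr]
  refine ⟨A, ?_, ?_⟩
  · ext k
    simp only [Finset.mem_map, Finset.mem_univ, true_and, eY_apply]
    constructor
    · rintro ⟨y, rfl⟩
      rw [hAinl]
      exact (e1.symm y).2
    · intro hk
      refine ⟨e1 ⟨k, hk⟩, ?_⟩
      rw [hAinl, Equiv.symm_apply_apply]
  · ext k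
    simp only [Finset.mem_map, Finset.mem_univ, true_and, eZ_apply]
    constructor
    · rintro ⟨z, rfl⟩
      rw [hAinr, Finset.mem_compl]
      exact (e2'.symm z).2
    · intro hk
      rw [Finset.mem_compl] at hk
      refine ⟨e2' ⟨k, hk⟩, ?_⟩
      rw [hAinr, Equiv.symm_apply_apply]

/-- **Full rank passes to the derivatives** ([AlonKumarVolk2020, Prop. 8 (4)], global form):
if `g ∈ K[x_1, …, x_{2n}]` is of full rank then for every balanced `Y` and every variable `x`,
`rank M_{Y,Yᶜ}(∂g/∂x) ≥ 2^{n-1}`. [cite: AlonKumarVolk2020, Prop. 8] -/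
theorem rank_cm_pderiv_ge_of_isFullRank {g : MvPolynomial (Fin (2 * n)) K} (hg : IsFullRank n g)
    (Y : Finset (Fin (2 * n))) (hY : Y.card = n) (x : Fin (2 * n)) :
    2 ^ (n - 1) ≤ (cm (pderiv x g) Y Yᶜ).rank := by
  classical
  obtain ⟨A, hYA, hZA⟩ := exists_equiv_of_balanced Y hY
  have hfull : (cm g Y Yᶜ).rank = 2 ^ n := by
    rw [← hZA, ← hYA, ← rank_pdMatrix_rename]
    exact hg A
  have hYc : Yᶜ.card = n := by
    rw [Finset.card_compl, Fintype.card_fin, hY]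
    omega
  by_cases hx : x ∈ Y
  · have := rank_cm_pderiv_ge (disjoint_compl_right) (by rw [hfull, hY]) hx
    rwa [hY] at this
  · have hx' : x ∈ Yᶜ := Finset.mem_compl.2 hx
    rw [rank_cm_swap]
    have hfull' : (cm g Yᶜ Y).rank = 2 ^ Yᶜ.card := by rw [← rank_cm_swap, hfull, hYc]
    have := rank_cm_pderiv_ge (disjoint_compl_left) hfull' hx'
    rwa [hYc] at this

end Bridge

end Literature.Barriers.ValiantsHypothesis.AKV
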